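import Summits.HodgeConjecture.HodgeConjecture.Theorems.MarkmanPartnerTransportK3Sq2KugaSatakeMixedEndomorphisms
import Summits.HodgeConjecture.HodgeConjecture.Theorems.MarkmanPartnerTransportOrphanSR

/-!
# Route MarkmanPartnerTransport · support `PartnerTransport` (stmt-HodgeConjecture-19650) ∕ crux #5 — programme
# «KS-MIXED», step M6 (lemmas on the fourfold): abstract Hodge endomorphisms of `T(X)_ℚ` as route endomorphisms of
# `H²(X)`, and their cycle-inducedness GRANTED HC⁴(X) in the self-adjoint (real-multiplication) case

For a marked smooth projective `K3^{[2]}`-type fourfold `(X, φ, P, z)` with transcendental part `T' ⊆ H²_B(X)`: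

* `exists_routeEndo_of_mem_endAlgHK` — every `e ∈ End_Hdg(T(X)_ℚ)` (abstract) is the restriction of a ROUTE
  ENDOMORPHISM `Q` of `H²(X(ℂ); ℂ)`: rational, type-preserving, killing `N¹(X)`, with `q`-transcendental image
  (`Q = Θ ∘ (ι_{T'} ∘ e ∘ π_{T'})_ℂ ∘ Θ⁻¹`, `π_{T'}` the transcendental projector);
* `exists_corr_eq_of_routeEndo_of_hodgeConjectureForHK` — **GRANTED `HodgeConjectureFor 4 X`, a `q`-SELF-ADJOINT route
  endomorphism `Q` is cycle-induced**: its kappa class is a rational Hodge `(2,2)`-class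
  (`OrphanSR.kappaClass_mem_algebraicClasses_of_hodgeConjectureFor`), hence algebraic, hence `Q = [Z]_*`
  (`exists_corrAction_eq_of_kappaClass`, Charles–Markman + Verbitsky–Guan for the inverse BBF class).

Used by `…MixedTransportConverse` (HC⁴(X) ⇒ HC⁴(S × S) granted Kuga–Satake, real-multiplication case). THEOREMS ONLY;
no sorry, no definition, no named fact; nothing here says HC or any item is proved. Prover seat hodge-nonav-19652-p1
(gen 16), `--supports stmt-HodgeConjecture-19650`.

References: K. O'Grady, Commun. Contemp. Math. 10 (2008) §2–3; F. Charles, E. Markman, Compos. Math. 149 (2013)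
Thm. 1.1; B. Kahn, J. Murre, C. Pedrini (2007) §7.2 Prop. 7.2.3; C. Voisin, *Hodge Theory I* §7.1, §11.1.
-/

set_option linter.dupNamespace false

noncomputable section

namespace Summit.HodgeConjecture.HodgeConjecture.Theorems.MarkmanPartnerTransport.KugaSatakeMixed

open scoped TensorProduct
open CategoryTheory MonoidalCategory Literature.AlgebraicGeometry Literature.AlgebraicGeometry.Motives
open Literature.AlgebraicGeometry.HodgeTheory Literature.AlgebraicTopology.SingularHomology
open Literature.AlgebraicGeometry.Motives.HodgeStructure Literature.AlgebraicGeometry.Hyperkaehler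
open Literature.AlgebraicGeometry.Surfaces
open Summit.HodgeConjecture.HodgeConjecture.Ring2.AbelianAll
open Summit.HodgeConjecture.HodgeConjecture.Theorems.OddPrimeSquares
open Summit.HodgeConjecture.HodgeConjecture.Theorems.NikulinTwinTransport
open Summit.HodgeConjecture.HodgeConjecture.Theorems.MarkmanPartnerTransport.TranscendentalPresentation
open Summit.HodgeConjecture.HodgeConjecture.Theorems.MarkmanPartnerTransport.KugaSatakeSelf
open Summit.HodgeConjecture.HodgeConjecture.Theorems.MarkmanPartnerTransport.KugaSatakePair
open Summit.HodgeConjecture.HodgeConjecture.Theorems.MarkmanPartnerTransport.KugaSatakeHK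
open Summit.HodgeConjecture.HodgeConjecture.Theorems.MarkmanPartnerTransport.PartnerLattice

variable {S X : SchemeOver ℂ} {φ : complexBetti X 2 ≃ₗ[ℂ] (K3HilbertIndex → ℂ)} {PX : complexBetti X (2 * 4)}
  {z : K3HilbertIndex → ℂ}

/-- `MarkedK3Sq[X, φ, P, z]`: VERBATIM the `let MarkedK3Sq := …` binder of the route declarations of
MarkmanPartnerTransport (clauses (m1)–(m6)). Local notation only. -/
local notation3 (prettyPrint := false) "MarkedK3Sq[" X ", " φ ", " P ", " z "]" =>
  (((IsIntegralClass P ∧ ∀ Q : complexBetti X (2 * 4), IsIntegralClass Q → ∃ n : ℤ, Q = n • P) ∧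
    (∀ c : complexBetti X 2, IsIntegralClass c ↔ ∃ v : K3HilbertIndex → ℤ, φ c = fun i => (v i : ℂ)) ∧
    (∀ a : complexBetti X 2, cupPowTwo a 4 = ((3 : ℂ) * (k3HilbertForm 2 (φ a) (φ a)) ^ 2) • P) ∧
    (IsOfHodgeType 4 X 2 2 0 (LinearEquiv.symm φ z) ∧
      ∀ τ : complexBetti X 2, IsOfHodgeType 4 X 2 2 0 τ → ∃ t : ℂ, τ = t • LinearEquiv.symm φ z) ∧
    (∀ c : complexBetti X 2, IsOfHodgeType 4 X 2 1 1 c ↔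
      (k3HilbertForm 2 (φ c) z = 0 ∧ k3HilbertForm 2 (φ c) (star z) = 0)) ∧
    (k3HilbertForm 2 z z = 0 ∧ 0 < (k3HilbertForm 2 (star z) z).re)))

/-- `H²[hS]`: the weight-two `ℚ`-Hodge structure on `H²(S(ℂ); ℚ)` of the real Hodge model of the surface `S`. -/
local notation3 "H²[" hS "]" =>
  bettiTwoHodgeStructure hS (BettiUniverse.realHodgeModel exists_isReal_hodgeModel_holds hS)
    (BettiUniverse.realHodgeModel_isHodgeSymmetric exists_isReal_hodgeModel_holds hS)

/-- `T[hS] = T(S)_ℚ = Hdg¹^⊥ ⊆ H²(S(ℂ); ℚ)`. -/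
local notation3 "T[" hS "]" =>
  transcendentalLatticeBetti hS (BettiUniverse.realHodgeModel exists_isReal_hodgeModel_holds hS)
    (BettiUniverse.realHodgeModel_isHodgeSymmetric exists_isReal_hodgeModel_holds hS)

/-- `H²_B[hX]`: the weight-two `ℚ`-Hodge structure on `H²(X(ℂ); ℚ)` of the real Hodge model of the fourfold `X`. -/
local notation3 "H²_B[" hX "]" =>
  bettiTwoHodgeStructureOfModel hX (BettiUniverse.realHodgeModel exists_isReal_hodgeModel_holds hX)
    (BettiUniverse.realHodgeModel_isHodgeSymmetric exists_isReal_hodgeModel_holds hX)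

/-- `Θ : ℂ ⊗_ℚ H²(Y(ℂ); ℚ) → H²(Y(ℂ); ℂ)` (`Y = S` or `X`). -/
local notation3 "Θ[" Y "]" => ofRatClassBaseChange (Motives.ComplexPoints Y) (2 * 1)

/-- `ι : H²(Y(ℂ); ℚ) → H²(Y(ℂ); ℂ)`, the rational lattice. -/
local notation3 "ι[" Y "]" => ofRatClass (Motives.ComplexPoints Y) (2 * 1)

/-- `Transc[S, y]`: `y` is cup-orthogonal to `N¹(S) = algebraicClasses S 1`. -/
local notation3 (prettyPrint := false) "Transc[" S ", " y "]" =>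
  (∀ d ∈ algebraicClasses S 1, cupProduct (rfl : 2 * 1 + 2 * 1 = 2 * 2) y d = 0)

/-- `BBF[X, φ, y]`: `y` is `q`-orthogonal to `N¹(X) = algebraicClasses X 1`. -/
local notation3 (prettyPrint := false) "BBF[" X ", " φ ", " y "]" =>
  (∀ e : complexBetti X 2, e ∈ algebraicClasses X 1 → k3HilbertForm 2 (φ y) (φ e) = 0)

/-! ### §1 Abstract Hodge endomorphisms of `T(X)_ℚ` are restrictions of route endomorphisms -/

/-- **Every `e ∈ End_Hdg(T(X)_ℚ)` is the restriction of a route endomorphism of `H²(X)`**: for `T' ⊆ H²_B(X)` the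
transcendental part (cut out by `q`-orthogonality to the rational Hodge classes) and `e ∈ T'.endAlg`, the
complexification `Q` of `ι_{T'} ∘ e ∘ π_{T'}` is rational, type-preserving, kills `N¹(X)`, has `q`-transcendental
image, and `Q(t' ⊗ 1) = e(t') ⊗ 1`. [cite: KahnMurrePedrini2007, §7.2 Prop. 7.2.3 (i)] [cite: VoisinHodgeI2002, §7.1.1] -/
theorem exists_routeEndo_of_mem_endAlgHK (hX : IsSmoothProjective (2 * 2) X) (hM : MarkedK3Sq[X, φ, PX, z])
    {T' : SubHodgeStructure (H²_B[hX])} (htr' : (H²_B[hX]).IsTranscendentalPart T')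
    (hT' : ∀ x : bettiCohomology X (2 * 1), x ∈ T'.toSubmodule ↔
      ∀ h ∈ (H²_B[hX]).hodgeClasses 1, k3HilbertForm 2 (φ (ι[X] x)) (φ (ι[X] h)) = 0)
    {e : Module.End ℚ T'.toSubmodule} (he : e ∈ T'.toHodgeStructure.endAlg) :
    ∃ Q : complexBetti X 2 →ₗ[ℂ] complexBetti X 2,
      (∀ y, IsRationalClass y → IsRationalClass (Q y)) ∧
      (∀ (i j : ℕ) y, IsOfHodgeType 4 X 2 i j y → IsOfHodgeType 4 X 2 i j (Q y)) ∧
      (∀ d : complexBetti X 2, d ∈ algebraicClasses X 1 → Q d = 0) ∧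
      (∀ y : complexBetti X 2, BBF[X, φ, Q y]) ∧
      ∀ t : T'.toSubmodule, Q (ι[X] (t : bettiCohomology X (2 * 1))) =
        ι[X] ((e t : T'.toSubmodule) : bettiCohomology X (2 * 1)) := by
  classical
  haveI : Module.Finite ℚ (bettiCohomology X (2 * 1)) := BettiUniverse.finite hX (2 * 1)
  have hK3 := isOfK3Type_bettiTwoHK hX hM
  have hpol := isPolarizable_bettiTwoHK hX
  obtain ⟨p, hp1, hp0⟩ := IsTranscendentalPart.exists_transcendentalProjector hK3 hpol htr'
  have hrange := IsTranscendentalPart.range_transcendentalProjector hK3 hpol htr' hp1 hp0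
  have hmemT : ∀ v, (p : Module.End ℚ (bettiCohomology X (2 * 1))) v ∈ T'.toSubmodule :=
    fun v => hrange ▸ LinearMap.mem_range_self _ v
  set pHom : Hom (H²_B[hX]) T'.toHodgeStructure := (endAlg.toHom p).codRestrict T' hmemT with hpHom
  set F : Hom (H²_B[hX]) (H²_B[hX]) := T'.subtypeHom.comp ((endAlg.toHom ⟨e, he⟩).comp pHom) with hF
  have hFapply : ∀ v, F.toLinearMap v = ((e (pHom.toLinearMap v) : T'.toSubmodule) : bettiCohomology X (2 * 1)) :=
    fun v => rfl
  have hpHom : ∀ v, (pHom.toLinearMap v : bettiCohomology X (2 * 1)) = (p : Module.End ℚ _) v := fun v => rfl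
  have hF0 : ∀ h ∈ (H²_B[hX]).hodgeClasses 1, F.toLinearMap h = 0 := by
    intro h hh
    have h0 : pHom.toLinearMap h = 0 := Subtype.ext (by rw [hpHom, hp0 h hh, Submodule.coe_zero])
    rw [hFapply, h0, map_zero, Submodule.coe_zero]
  have hFt : ∀ t : T'.toSubmodule, F.toLinearMap (t : bettiCohomology X (2 * 1)) =
      ((e t : T'.toSubmodule) : bettiCohomology X (2 * 1)) := by
    intro t
    have h1 : pHom.toLinearMap (t : bettiCohomology X (2 * 1)) = t := Subtype.ext (by rw [hpHom, hp1 _ t.2])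
    rw [hFapply, h1]
  have hFmem : F.toLinearMap ∈ (H²_B[hX]).endAlg := Hom.toLinearMap_mem_endAlg F
  have hFcomp : F.toLinearMap = T'.toSubmodule.subtype ∘ₗ ((endAlg.toHom ⟨e, he⟩).comp pHom).toLinearMap := rfl
  -- the complexification `Q`
  let Θe : (ℂ ⊗[ℚ] bettiCohomology X (2 * 1)) ≃ₗ[ℂ] complexBetti X (2 * 1) :=
    LinearEquiv.ofBijective (Θ[X]) ⟨ofRatClassBaseChange_injective _ _, ofRatClassBaseChange_surjective hX (2 * 1)⟩
  have hΘe : ∀ x, Θe x = Θ[X] x := fun _ => rfl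
  have hΘe_symm : ∀ x, Θe.symm (Θ[X] x) = x := fun x => by
    apply Θe.injective; rw [LinearEquiv.apply_symm_apply, hΘe]
  set Q : complexBetti X 2 →ₗ[ℂ] complexBetti X 2 :=
    Θe.toLinearMap ∘ₗ F.toLinearMap.baseChange ℂ ∘ₗ Θe.symm.toLinearMap with hQ
  have hQapply : ∀ x, Q (Θ[X] x) = Θ[X] (F.toLinearMap.baseChange ℂ x) := fun x => by
    change Θe (F.toLinearMap.baseChange ℂ (Θe.symm (Θ[X] x))) = _
    rw [hΘe_symm, hΘe]
  refine ⟨Q, fun y hy => ?_, fun i j y hy => ?_, fun d hd => ?_, fun y => ?_, fun t => ?_⟩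
  · -- rational
    obtain ⟨w, rfl⟩ := (isRationalClass_iff_mem_range_ofRatClass y).1 hy
    rw [← one_smul ℂ (ι[X] w), ← ofRatClassBaseChange_tmul, hQapply, LinearMap.baseChange_tmul,
      ofRatClassBaseChange_tmul, one_smul]
    exact isRationalClass_ofRatClass _
  · -- type-preserving
    obtain ⟨x, rfl⟩ := ofRatClassBaseChange_surjective hX (2 * 1) y
    by_cases hij : i + j = 2
    · have hx : x ∈ (H²_B[hX]).piece i j := (mem_pieceHK_iff_isOfHodgeType hX hij x).2 hy
      have h := endAlg.baseChange_mem_piece ⟨F.toLinearMap, hFmem⟩ hx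
      rw [mem_pieceHK_iff_isOfHodgeType hX hij] at h
      rw [hQapply]
      exact h
    · have hij' : i + j ≠ 2 * 1 := by omega
      have hy0 : Θ[X] x = 0 := by
        obtain ⟨A, hA⟩ := hy
        rw [(A.hodgePQ_eq_bot_iff (2 * 1) i j).2 (Literature.NumberTheory.Transcendental.hodgePQ_eq_bot_of_ne hij'),
          Submodule.mem_bot] at hA
        exact A.pullback_injective (2 * 1) (by rw [hA, map_zero])
      have hx0 : x = 0 := ofRatClassBaseChange_injective _ _ (by rw [hy0, map_zero])
      rw [hx0, map_zero, map_zero]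
      exact IsOfHodgeType.zero (BettiUniverse.realHodgeModel exists_isReal_hodgeModel_holds hX) _ _ _
  · -- kills `N¹(X)`
    rw [← map_hodgeClassesHK_baseChange_eq hX] at hd
    obtain ⟨u, hu, rfl⟩ := hd
    obtain ⟨u', rfl⟩ := hu
    rw [hQapply]
    induction u' using TensorProduct.induction_on with
    | zero => rw [map_zero, map_zero, map_zero]
    | tmul c h =>
      rw [LinearMap.baseChange_tmul, Submodule.subtype_apply, LinearMap.baseChange_tmul, hF0 _ h.2,
        TensorProduct.tmul_zero, map_zero]
    | add x y hx hy => rw [map_add, map_add, map_add, hx, hy, add_zero]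
  · -- `q`-transcendental image
    obtain ⟨x, rfl⟩ := ofRatClassBaseChange_surjective hX (2 * 1) y
    rw [hQapply, hFcomp, LinearMap.baseChange_comp, LinearMap.comp_apply]
    exact bbfTransc_of_baseChange hX T' hT' _
  · -- restriction to `T'`
    rw [← one_smul ℂ (ι[X] (t : bettiCohomology X (2 * 1))), ← ofRatClassBaseChange_tmul, hQapply,
      LinearMap.baseChange_tmul, ofRatClassBaseChange_tmul, one_smul, hFt]

/-! ### §2 Granted HC⁴(X), a `q`-self-adjoint route endomorphism is cycle-induced -/

/-- **Granted `HodgeConjectureFor 4 X`, a `q`-SELF-ADJOINT rational type-preserving endomorphism `Q` of `H²(X)` is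
CYCLE-INDUCED** on a marked smooth projective `K3^{[2]}`-type fourfold: `κ_Q` is a rational Hodge `(2,2)`-class, hence
algebraic, hence `Q = [Z]_*` for an algebraic `Z ∈ A⁴(X × X)` (`exists_corrAction_eq_of_kappaClass`, modulo
{Verbitsky–Guan, Charles–Markman}). CONDITIONAL on HC⁴(X) and the two records as displayed.
[cite: OGrady2008NumericalK3Square, §2–3] [cite: CharlesMarkman2013, Thm. 1.1 (§1)] -/
theorem exists_corr_eq_of_routeEndo_of_hodgeConjectureForHK
    (hV : VerbitskyGuan_cohomology_K3HilbertSquareType) (hCM : CharlesMarkman2013_lefschetzStandard_K3HilbertType)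
    (hX : IsSmoothProjective 4 X) (hK : IsOfK3HilbertSquareType X) (hM : MarkedK3Sq[X, φ, PX, z])
    (hHC : HodgeConjectureFor 4 X) (Q : complexBetti X 2 →ₗ[ℂ] complexBetti X 2)
    (h1 : ∀ y, IsRationalClass y → IsRationalClass (Q y))
    (h2 : ∀ (i j : ℕ) y, IsOfHodgeType 4 X 2 i j y → IsOfHodgeType 4 X 2 i j (Q y))
    (hsa : ∀ y w : complexBetti X 2, k3HilbertForm 2 (φ (Q y)) (φ w) = k3HilbertForm 2 (φ y) (φ (Q w))) :
    ∃ W : complexBetti X 2 →ₗ[ℂ] complexBetti X 2, IsAlgebraicCorrespondence 4 4 X X W ∧ ∀ y, W y = Q y := by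
  obtain ⟨Z, hZ, hQZ⟩ := exists_corrAction_eq_of_kappaClass hV hCM hX hK hM Q hsa
    (OrphanSR.kappaClass_mem_algebraicClasses_of_hodgeConjectureFor hX hM hHC Q h1 h2)
  exact ⟨corrAction complexOrientationFamily hX hX (rfl : 2 + 2 * 4 = 2 + 2 * 4) Z,
    isAlgebraicCorrespondence_corrAction_complex hX hX _ (by norm_num) hZ, fun y => (hQZ y).symm⟩

end Summit.HodgeConjecture.HodgeConjecture.Theorems.MarkmanPartnerTransport.KugaSatakeMixed

end
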